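import Literature.NumberTheory.Automorphic.FLSModFiveImageSqrtFive

/-!
# Route `SqrtFiveQuarticCovers`, crux `ReductionToRefinedLocus` (stmt-Langlands-17834), line `birth`:
# the registered stub `stub_fiveSpanOdd` modulo FLS 2015 Thm. 3 ALONE, for EVERY totally real `K`

The load-bearing stub of the skeleton `Cruxes/ReductionToRefinedLocus/Lines/birth.lean` reads: for `K`
a totally real number field (ANY degree, no hypothesis on `√5`) and `E / 𝓞 K` (`Δ ≠ 0`) not modular
in the trace-only sense (`IsModularEllipticCurve`, written out), some framing `ρ̄` of `E[5]`
(`IsTorsionGaloisRep`, written out) has (ii) an element `ρ̄(σ)` of trace `0` and determinant `-1`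
and (i′) determinant-one image elements that do not span `M₂(𝔽₅)`.

This file proves exactly that registered signature as the CONCLUSION of
`stub_fiveSpanOdd_of_FLS2015_theorem3`, from the single named fact
`Literature.NumberTheory.Automorphic.FLS2015_theorem3` (Freitas–Le Hung–Siksek 2015, Thm. 3, a
modularity lifting theorem — not provable in the tree today).  The tree's sibling
`FLS2015.modFive_image_of_not_isModularEllipticCurve` needs `√5 ∈ K` (it also delivers
`det ⊆ {±1}` and irreducibility); here neither is needed: from Thm. 3 (contrapositive) we get a
framing `ρ̄` whose restriction to `Γ_{K(ζ₅)}` is not absolutely irreducible; (ii) is the image of a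
complex conjugation (`det ρ̄ = χ̄₅` by the Weil pairing, `K` has a real place, Cayley–Hamilton);
(i′) is Prop. 3.1 (i) of the source (the determinant-one elements come from `Γ_{K(ζ₅)}`) and the
easy half of Burnside (`FLS2015.span_ne_top_of_common_eigenvector`).

HONEST STATUS: CONDITIONAL on `FLS2015_theorem3` (hypothesis `h3`); it does not close the stub
by name (the registered stub has no such hypothesis and is, in substance, FLS Thm. 3 itself) and
proves modularity of nothing.  Helper of stmt-Langlands-17834 (`--supports`).

References: [FreitasLeHungSiksek2015] N. Freitas, B. V. Le Hung, S. Siksek, *Elliptic curves over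
real quadratic fields are modular*, Invent. Math. 201 (2015) 159–206, Thm. 3, Prop. 3.1 (i),
proof of Prop. 9.1 (i)–(ii) (arXiv:1310.7088 pp. 4, 10, 19).
-/

set_option linter.dupNamespace false -- project-wide option; `Summit.Langlands.Langlands` is the mandated namespace

namespace Summit.Langlands.Langlands.Theorems.SqrtFiveQuarticCovers

open scoped NumberField Matrix
open Literature.NumberTheory.Automorphic Literature.NumberTheory.GaloisRepresentations

/-- **Registered stub `stub_fiveSpanOdd` (line `birth`, stmt-Langlands-17834) modulo FLS 2015
Thm. 3.**  Assuming `FLS2015_theorem3`: for every totally real `K` and every `E / 𝓞 K` with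
`Δ ≠ 0` that is not modular in the trace-only sense, some framing `ρ̄` of `E[5]` has an image
element of trace `0` and determinant `-1`, and the `𝔽₅`-span of the determinant-one elements of
`ρ̄(Γ_K)` is not `M₂(𝔽₅)`.  The conclusion is the registered stub signature verbatim.
[cite: FreitasLeHungSiksek2015, Thm. 3, Prop. 3.1 (i) and proof of Prop. 9.1 (i)–(ii)] -/
theorem stub_fiveSpanOdd_of_FLS2015_theorem3 (h3 : FLS2015_theorem3) :
    ∀ (K : Type) [Field K] [NumberField K], NumberField.IsTotallyReal K → ∀ E : WeierstrassCurve (NumberField.RingOfIntegers K), E.Δ ≠ 0 → ¬ ((E.baseChange K).HasCM ∨ ∃ (hF : Literature.NumberTheory.Automorphic.isCompact_glFiniteIntegralLevel 2 K) (π : Literature.NumberTheory.Automorphic.CuspidalAutomorphicRepData 2 K hF), π.1.HasWeightZero ∧ ∀ᶠ w : IsDedekindDomain.HeightOneSpectrum (NumberField.RingOfIntegers K) in Filter.cofinite, ∃ α : Multiset ℂ, π.1.HasSatakeParamAt w α ∧ ((Real.sqrt w.residueCard : ℝ) : ℂ) * α.sum = (Literature.NumberTheory.Automorphic.frobTraceAt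 E w : ℂ)) → ∃ ρ : Literature.NumberTheory.GaloisRepresentations.FramedGaloisRep K (ZMod 5) 2, (∃ e : (E.baseChange K).geomTorsion ((5 : ℕ) : ℤ) ≃+ (Fin 2 → ZMod 5), ∀ (σ : Field.absoluteGaloisGroup K) (P : (E.baseChange K).geomTorsion ((5 : ℕ) : ℤ)), e (σ • P) = ((ρ σ : GL (Fin 2) (ZMod 5)) : Matrix (Fin 2) (Fin 2) (ZMod 5)) *ᵥ (e P)) ∧ (∃ σ : Field.absoluteGaloisGroup K, Matrix.trace ((ρ σ : GL (Fin 2) (ZMod 5)) : Matrix (Fin 2) (Fin 2) (ZMod 5)) = 0 ∧ Matrix.det ((ρ σ : GL (Fin 2) (ZMod 5)) : Matrix (Fin 2) (Fin 2) (ZMod 5)) = -1) ∧ Submodule.span (ZMod 5) ((fun g : GL (Fin 2) (ZMod 5) => ((g : GL (Fin 2) (ZMod 5)) : Matrix (Fin 2) (Fin 2) (ZMod 5))) '' {g : GL (Fin 2) (ZMod 5) | g ∈ ρ.toMonoidHom.range ∧ Matrix.det ((g : GL (Fin 2) (ZMod 5)) : Matrix (Fin 2) (Fin 2) (ZMod 5))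 = 1}) ≠ ⊤ := by
  intro K _ _ hK E hΔ hne
  haveI := hK
  haveI : Fact (Nat.Prime 5) := ⟨by norm_num⟩
  haveI := FLS2015.isElliptic_baseChange hΔ
  obtain ⟨φ⟩ := FLS2015.exists_realEmbedding K
  have hne' : ¬ IsAutomorphicOfWeightZero E :=
    not_isAutomorphicOfWeightZero_of_not_isModularEllipticCurve hΔ hne
  -- FLS Thm. 3 at `p = 5`, contrapositive: a framing not absolutely irreducible on `Γ_{K(ζ₅)}`
  obtain ⟨ρ, hρ, L, _, _, _, hred⟩ :
      ∃ ρ : FramedGaloisRep K (ZMod 5) 2, (E.baseChange K).IsTorsionGaloisRep 5 ρ ∧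
        ∃ (L : Type) (_ : Field L) (_ : Algebra K L) (_ : IsCyclotomicExtension {5} K L),
          ¬ FramedRep.IsAbsolutelyIrreducible (FramedGaloisRep.restrictField L ρ) := by
    by_contra hall
    push Not at hall
    refine hne' (h3 K E hΔ 5 (Or.inr rfl) ?_)
    intro ρ hρ L _ _ _
    exact hall ρ hρ L inferInstance inferInstance inferInstance
  haveI : NeZero ((5 : ℕ) : K) := NeZero.charZero
  have hdet : ∀ σ, Matrix.GeneralLinearGroup.det (ρ σ) = modPCyclotomicCharacterZMod K 5 σ :=
    (E.baseChange K).det_eq_modPCyclotomicCharacter_of_isTorsionGaloisRep_holds 5 ρ hρ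
  refine ⟨ρ, hρ, ?_, ?_⟩
  · -- (ii) the image of a complex conjugation: `c² = 1`, `det = -1`, hence trace `0`
    obtain ⟨c, hcc, hcdet⟩ := exists_mul_self_eq_one_and_det_eq_neg_one_of_det_eq ρ hdet φ
    exact ⟨c,
      Literature.NumberTheory.GaloisRepresentations.FLS2015.trace_eq_zero_of_mul_self_eq_one
        (p := 5) (by decide) hcc hcdet,
      Literature.NumberTheory.GaloisRepresentations.FLS2015.det_coe_eq_neg_one hcdet⟩
  · -- (i′) the determinant-one part has a common eigenvector after a base change of `𝔽₅`
    obtain ⟨B, _, f, v, hv, hB⟩ :=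
      exists_eigenvector_of_det_eq_one_of_not_isAbsolutelyIrreducible_restrictField ρ hdet L hred
    refine FLS2015.span_ne_top_of_common_eigenvector f hv _ ?_
    rintro _ ⟨g, ⟨⟨σ, rfl⟩, hg1⟩, rfl⟩
    refine hB σ (Units.ext ?_)
    rw [Matrix.GeneralLinearGroup.val_det_apply, Units.val_one]
    exact hg1

end Summit.Langlands.Langlands.Theorems.SqrtFiveQuarticCovers
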